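/-
Copyright (c) 2026 the pub-hodgecm-mathlib formalisation cell (harness21).  Prover seat hodgecm-mathlib-K2E1-p11 (g2), Track B ∕ K2-LIT, h413 =
`stmt-HodgeConjecture-24833`, line `K2_E1_TraceFormulaBeta`, campaign «EIS-R7-BL-SPH-3» ∕ R8-LADDER-3, «MS-3» — THE GENERAL-BOX `_on'` EDITIONS AT `N = 3` (dealer K2E1-plan (g6) deal
(123)(ii) 2026-09-04T11:15:18Z): the `N = 3` PRINT of ★ p859607 `K2E1MaassSelbergContinuedOnBoxesCMTwo` (K2E4-p11 (g5)) — pole control on an open preconnected `D₁ ⊆ D⁺ = {Re > 1, Im > 0}`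
containing ANY two open sub-tube boxes `O₁`, `O₂'` with `2 < Re z′ < Re z` (needed when `D₁ = (D⁺ ∩ ball) ∖ (P ∪ (ball ∖ U_n))` only contains the fixed boxes up to a countable set).
-/
import Summits.HodgeConjecture.HodgeConjecture.Theorems.K2E1MaassSelbergContinuedOnCMThree   -- ★ (this seat, (123)(i)): the fixed-box `_on` edition at `N = 3`, `differentiableOn_fourTerm_fst_on∕_snd_conj_on`; brings ★ p859379 ∕ p859140 ∕ §A
import HarnessLib

/-!
# h413 ∕ Track B «K2-LIT», «MS-3» — `K2E1MaassSelbergContinuedOnBoxesCMThree`: POLE CONTROL OF THE CONTINUED INTERTWINING SCALAR OF `U(2,1)∕CM` ON AN OPEN PRECONNECTED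
# `D₁ ⊆ D⁺ = {Re > 1, Im > 0}` CONTAINING TWO ARBITRARY OPEN SUB-TUBE BOXES — the general-box `_on'` editions at `N = 3` (the fixed boxes of the `_on` edition replaced by binders `O₁`, `O₂'`)

Cell `pub/hodgecm-mathlib`, crux H413 = `stmt-HodgeConjecture-24833`, route `HCCMUnconditional`; dealer K2E1-plan (g6) deal (123)(ii).  THEOREMS ONLY; lane `--kind proof --supports
stmt-HodgeConjecture-24833 --as helper` (count-neutral; closes no socket).  Bytes = ★ p859607 with `D⁺ = {½ < Re} ↦ {1 < Re}`, `z + conj z′ − 1 ↦ − 2`, `Re z − ½ ↦ Re z − 1`, tube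
`{1 < Re} ↦ {2 < Re}`, `hsep : 1 < Re z′ < Re z ↦ 2 < Re z′ < Re z`, the `N = 3` four-term data of ★ p859140 ∕ ★ `exists_fourTerm_tube_cm_three`; nothing else.
WHY THE GENERAL BOXES.  The holomorphy domain one ball `n` of Bernstein–Lapid provides at `N = 3` is `(D⁺ ∩ ball 0 (n+2)) ∩ U_n ∖ P` (★ CLOSER₃ `exists_truncatedFamily_cm_three_upper`) — an open
convex set minus a COUNTABLE set (★ `K2E1ConvexDiffCountableConnected`): preconnected, but containing the fixed boxes `{4 < Re < 5}`, `{2 < Re < 3}` of the `_on` edition only up to that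
countable set; any open non-empty `O₁ ⊆ D₁ ∩ {4 < Re < 5}`, `O₂' ⊆ D₁ ∩ {2 < Re < 3}` will do here.  The locally uniform bound (a2) near a putative pole `z₁ ∈ P ∩ D⁺` is what the
removable-singularity bricks ((L4)₃) and the pole-exclusion file (123)(iii) consume.
* §2 **`poleControl_continued_cm_three_of_pairing_on'`**;  §3 **`poleControl_continued_cm_three_of_family_on'`**.
HONEST LABEL.  Count-neutral helper; proves no printed statement; conditional on `Φ`∕`F`, `hc`, `hceq`; HC_CM is proved only modulo the 7 printed citations (2 remaining named inputs: hLiu418 =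
`stmt-HodgeConjecture-24832`, h413 = `stmt-HodgeConjecture-24833`) until rung 0 closes.

## References
* [MoeglinWaldspurger1995] C. Mœglin, J.-L. Waldspurger, *Spectral decomposition and Eisenstein series* (1995), IV.2.3, IV.3.12 (a).
* [Arthur1980TraceFormulaII] J. Arthur, *A trace formula for reductive groups II*, Compositio Math. 40 (1980), §4.
* [BernsteinLapid2019] J. Bernstein, E. Lapid, *On the meromorphic continuation of Eisenstein series*, J. AMS 37 (2024), §4.
-/

set_option autoImplicit false
set_option linter.dupNamespace false  -- the mandated namespace repeats the summit's segment (`HodgeConjecture.HodgeConjecture`)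

noncomputable section

open MeasureTheory Measure NumberField IsDedekindDomain Set Filter Topology Metric MulAction
open scoped ENNReal NNReal ComplexConjugate InnerProductSpace
open Literature.MeasureTheory.Group Literature.NumberTheory
open Literature.NumberTheory.Automorphic Literature.NumberTheory.Automorphic.UnitaryGroup AdelicGroupData
open Summit.HodgeConjecture.HodgeConjecture.Cruxes.H413.K2E1BorelEisensteinU
open Summit.HodgeConjecture.HodgeConjecture.Cruxes.H413.K2E1MaassSelbergPoleControl (poleControl_of_fourTerm)
open Summit.HodgeConjecture.HodgeConjecture.Cruxes.H413.K2E1MaassSelbergContinuedCMTwo (differentiableOn_conj_comp_conj eqOn_prod_of_separately_differentiableOn)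
open Summit.HodgeConjecture.HodgeConjecture.Cruxes.H413.K2E1MaassSelbergContinuedCMThree (add_sub_two_ne_zero_and_sub_ne_zero)
open Summit.HodgeConjecture.HodgeConjecture.Cruxes.H413.K2E1MaassSelbergPairingCMTwo (pairing_of_differentiableOn)
open Summit.HodgeConjecture.HodgeConjecture.Cruxes.H413.K2E1MaassSelbergPairingContinuedCMThree (exists_fourTerm_tube_cm_three)
open Summit.HodgeConjecture.HodgeConjecture.Cruxes.H413.K2E1MaassSelbergSphericalBracketsCMThree (measureReal_maximalCompact_pos idelicBracket_pos)

namespace Summit.HodgeConjecture.HodgeConjecture.Cruxes.H413.K2E1MaassSelbergContinuedOnBoxesCMThree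

open Summit.HodgeConjecture.HodgeConjecture.Cruxes.H413.K2E1MaassSelbergContinuedOnCMThree (differentiableOn_fourTerm_fst_on differentiableOn_fourTerm_snd_conj_on)

/-! ## §2 Pole control on `D₁`, modulo the pairing -/

section Head

/-- **POLE CONTROL OF THE CONTINUED SCALAR ON AN OPEN PRECONNECTED `D₁ ⊆ D⁺` CONTAINING TWO SUB-TUBE BOXES `O₁`, `O₂'` (open, non-empty, `2 < Re z′ < Re z` for `z ∈ O₁`, `z′ ∈ O₂'`)** —
the general-box `_on'` edition of ★ `poleControl_continued_cm_three_of_pairing[_on]`: `c̃`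
holomorphic on `D₁`, the pairing `Φ(·, z′)` holomorphic on `D₁` for `z′ ∈ D₁`, `w ↦ Φ(z, conj w)` holomorphic on `conj⁻¹ D₁` for `z ∈ D₁`, `Φ = R(z,z′;c̃)` on the sub-tube inside `D₁ × D₁`,
`Φ z z = Q z ≥ 0` on `D₁`; THEN (a1)∧(a2)∧(a3) of ★ p859140 at every `z ∈ D₁`. [cite: MoeglinWaldspurger1995, IV.2.3, IV.3.12 (a)] [cite: Arthur1980TraceFormulaII, §4] -/
theorem poleControl_continued_cm_three_of_pairing_on' {D₁ : Set ℂ} (hD₁ : IsOpen D₁) (hD₁c : IsPreconnected D₁) (hD₁sub : D₁ ⊆ {z : ℂ | 1 < z.re ∧ 0 < z.im})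
    {O₁ O₂' : Set ℂ} (hO₁ : IsOpen O₁) (hO₁ne : O₁.Nonempty) (hO₁D : O₁ ⊆ D₁) (hO₂' : IsOpen O₂') (hO₂'ne : O₂'.Nonempty) (hO₂'D : O₂' ⊆ D₁)
    (hsep : ∀ z ∈ O₁, ∀ z' ∈ O₂', 2 < z'.re ∧ z'.re < z.re)
    {T cμ K κ m : ℝ} (hT : 1 ≤ T) (hcμ : 0 < cμ) (hK : 0 < K) (hκ : 0 < κ) (hm : 0 < m) {φ₀ : ℂ} (hφ₀ : φ₀ ≠ 0)
    {c : ℂ → ℂ} (hc : DifferentiableOn ℂ c D₁)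
    {Φ : ℂ → ℂ → ℂ}
    (hΦ₁ : ∀ z' ∈ D₁, DifferentiableOn ℂ (fun z : ℂ => Φ z z') D₁)
    (hΦ₂ : ∀ z ∈ D₁, DifferentiableOn ℂ (fun w : ℂ => Φ z (conj w)) {w : ℂ | conj w ∈ D₁})
    (hrel : ∀ z ∈ D₁, ∀ z' ∈ D₁, 2 < z'.re → z'.re < z.re →
      Φ z z' = ((cμ : ℝ) : ℂ) * (((K : ℝ) : ℂ) *
        ((((T : ℝ) : ℂ) ^ (z + conj z' - 2) / (z + conj z' - 2)) * (((κ : ℝ) : ℂ) * (((m : ℝ) : ℂ) * (φ₀ * conj φ₀)))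
          + (((T : ℝ) : ℂ) ^ (z - conj z') / (z - conj z')) * (((κ : ℝ) : ℂ) * (((m : ℝ) : ℂ) * (φ₀ * conj (c z' * φ₀))))
          - (((T : ℝ) : ℂ) ^ (-(z - conj z')) / (z - conj z')) * (((κ : ℝ) : ℂ) * (((m : ℝ) : ℂ) * (c z * φ₀ * conj φ₀)))
          - (((T : ℝ) : ℂ) ^ (-(z + conj z' - 2)) / (z + conj z' - 2)) * (((κ : ℝ) : ℂ) * (((m : ℝ) : ℂ) * (c z * φ₀ * conj (c z' * φ₀)))))))
    {Q : ℂ → ℝ} (hQ : ∀ z ∈ D₁, 0 ≤ Q z ∧ Φ z z = ((Q z : ℝ) : ℂ))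
    {z : ℂ} (hzD : z ∈ D₁) :
    Real.sqrt (κ * m * ‖c z‖ ^ 2 * ‖φ₀‖ ^ 2) ≤ (z.re - 1) * T ^ (2 * (z.re - 1)) * Real.sqrt (κ * m * ‖φ₀‖ ^ 2) / |z.im| +
        Real.sqrt ((z.re - 1) ^ 2 * T ^ (4 * (z.re - 1)) * (κ * m * ‖φ₀‖ ^ 2) / z.im ^ 2 + (κ * m * ‖φ₀‖ ^ 2) * T ^ (4 * (z.re - 1))) ∧
      (∀ {x₁ x₂ η : ℝ}, 0 < x₁ → (z.re - 1) ∈ Set.Icc x₁ x₂ → 0 < η → η ≤ |z.im| →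
        κ * m * ‖c z‖ ^ 2 * ‖φ₀‖ ^ 2 ≤ (x₂ * T ^ (2 * x₂) * Real.sqrt (κ * m * ‖φ₀‖ ^ 2) / η + Real.sqrt (x₂ ^ 2 * T ^ (4 * x₂) * (κ * m * ‖φ₀‖ ^ 2) / η ^ 2 + (κ * m * ‖φ₀‖ ^ 2) * T ^ (4 * x₂))) ^ 2) ∧
      (|z.im| ≤ 1 → κ * m * ‖c z‖ ^ 2 * ‖φ₀‖ ^ 2 ≤ ((z.re - 1) * T ^ (2 * (z.re - 1)) * Real.sqrt (κ * m * ‖φ₀‖ ^ 2) +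
        Real.sqrt ((z.re - 1) ^ 2 * T ^ (4 * (z.re - 1)) * (κ * m * ‖φ₀‖ ^ 2) + (κ * m * ‖φ₀‖ ^ 2) * T ^ (4 * (z.re - 1)))) ^ 2 / z.im ^ 2) := by
  have hT0 : 0 < T := lt_of_lt_of_le one_pos hT
  -- (1) the identity on `D⁺ × D⁻` in the variables `(z, w = conj z′)`
  set F : ℂ → ℂ → ℂ := fun z w => Φ z (conj w) with hF_def
  set G : ℂ → ℂ → ℂ := fun z w =>
      ((cμ : ℝ) : ℂ) * (((K : ℝ) : ℂ) *
        ((((T : ℝ) : ℂ) ^ (z + w - 2) / (z + w - 2)) * (((κ : ℝ) : ℂ) * (((m : ℝ) : ℂ) * (φ₀ * conj φ₀)))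
          + (((T : ℝ) : ℂ) ^ (z - w) / (z - w)) * (((κ : ℝ) : ℂ) * (((m : ℝ) : ℂ) * (φ₀ * conj (c (conj w) * φ₀))))
          - (((T : ℝ) : ℂ) ^ (-(z - w)) / (z - w)) * (((κ : ℝ) : ℂ) * (((m : ℝ) : ℂ) * (c z * φ₀ * conj φ₀)))
          - (((T : ℝ) : ℂ) ^ (-(z + w - 2)) / (z + w - 2)) * (((κ : ℝ) : ℂ) * (((m : ℝ) : ℂ) * (c z * φ₀ * conj (c (conj w) * φ₀)))))) with hG_def
  have hz : z ∈ {z : ℂ | 1 < z.re ∧ 0 < z.im} := hD₁sub hzD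
  -- `D₂ := conj⁻¹ D₁` is open and preconnected
  have hD₂ : IsOpen {w : ℂ | conj w ∈ D₁} := hD₁.preimage Complex.continuous_conj
  have hD₂c : IsPreconnected {w : ℂ | conj w ∈ D₁} := by
    have h1 : {w : ℂ | conj w ∈ D₁} = (fun z : ℂ => conj z) '' D₁ := by
      ext w
      refine ⟨fun hw => ⟨conj w, hw, Complex.conj_conj w⟩, ?_⟩
      rintro ⟨z, hz1, rfl⟩
      show conj (conj z) ∈ D₁
      rw [Complex.conj_conj]; exact hz1
    rw [h1]
    exact hD₁c.image _ Complex.continuous_conj.continuousOn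
  have hconjD : ∀ w ∈ {w : ℂ | conj w ∈ D₁}, conj w ∈ D₁ := fun w hw => hw
  have hF₁ : ∀ w ∈ {w : ℂ | conj w ∈ D₁}, DifferentiableOn ℂ (fun z => F z w) D₁ := fun w hw => hΦ₁ (conj w) (hconjD w hw)
  have hG₁ : ∀ w ∈ {w : ℂ | conj w ∈ D₁}, DifferentiableOn ℂ (fun z => G z w) D₁ := fun w hw => by
    have h := differentiableOn_fourTerm_fst_on hD₁sub (cμ := cμ) (K := K) (κ := κ) (m := m) hT0 φ₀ hc (hD₁sub (hconjD w hw))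
    simp only [Complex.conj_conj] at h
    exact h
  have hF₂ : ∀ z ∈ D₁, DifferentiableOn ℂ (fun w => F z w) {w : ℂ | conj w ∈ D₁} := fun z hz => hΦ₂ z hz
  have hG₂ : ∀ z ∈ D₁, DifferentiableOn ℂ (fun w => G z w) {w : ℂ | conj w ∈ D₁} := fun z hz =>
    differentiableOn_fourTerm_snd_conj_on hD₁ hD₁sub (cμ := cμ) (K := K) (κ := κ) (m := m) hT0 φ₀ hc (hD₁sub hz)
  -- the boxes: `O₁ ⊆ D₁`, `O₂ := conj⁻¹ O₂' ⊆ D₂`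
  have hO₂ : IsOpen {w : ℂ | conj w ∈ O₂'} := hO₂'.preimage Complex.continuous_conj
  have hO₂ne : ({w : ℂ | conj w ∈ O₂'} : Set ℂ).Nonempty := by
    obtain ⟨z', hz'⟩ := hO₂'ne
    exact ⟨conj z', show conj (conj z') ∈ O₂' by rw [Complex.conj_conj]; exact hz'⟩
  have hO₂D : {w : ℂ | conj w ∈ O₂'} ⊆ {w : ℂ | conj w ∈ D₁} := fun w hw => hO₂'D hw
  have heq : ∀ z ∈ O₁, ∀ w ∈ {w : ℂ | conj w ∈ O₂'}, F z w = G z w := by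
    intro z hz w hw
    obtain ⟨h1, h2⟩ := hsep z hz (conj w) hw
    have h := hrel z (hO₁D hz) (conj w) (hO₂'D hw) h1 h2
    simp only [Complex.conj_conj] at h
    exact h
  have hid := eqOn_prod_of_separately_differentiableOn hD₁ hD₁c hD₂ hD₂c hO₁ hO₁ne hO₁D hO₂ hO₂ne hO₂D hF₁ hG₁ hF₂ hG₂ heq
  -- (2) the diagonal `w = conj z`
  have hzc : conj z ∈ {w : ℂ | conj w ∈ D₁} := by
    show conj (conj z) ∈ D₁
    rw [Complex.conj_conj]; exact hzD
  have hdiag := hid z hzD (conj z) hzc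
  simp only [hF_def, hG_def, Complex.conj_conj] at hdiag
  obtain ⟨hQ0, hQeq⟩ := hQ z hzD
  rw [hQeq] at hdiag
  -- (3) ★ `poleControl_of_fourTerm` with `c₁ = cμ`, `c₂ = K`, `a = κm|φ₀|²`, `b = κm|c̃ z|²|φ₀|²`, `W = κm·φ₀·conj(c̃ z·φ₀)`
  have hx : 0 < z.re - 1 := by linarith [hz.1]
  have hy : z.im ≠ 0 := ne_of_gt hz.2
  obtain ⟨hs₁, hs₂⟩ : z + conj z - 2 = ((2 * (z.re - 1) : ℝ) : ℂ) ∧ z - conj z = ((2 * z.im : ℝ) : ℂ) * Complex.I :=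
    ⟨by rw [Complex.add_conj]; push_cast; ring, Complex.sub_conj z⟩
  have hnorm : φ₀ * conj φ₀ = ((‖φ₀‖ ^ 2 : ℝ) : ℂ) := by rw [Complex.mul_conj, Complex.normSq_eq_norm_sq]
  have ha : 0 < κ * m * ‖φ₀‖ ^ 2 := by positivity
  have hb : 0 ≤ κ * m * ‖c z‖ ^ 2 * ‖φ₀‖ ^ 2 := by positivity
  have hB₁ : ((κ : ℝ) : ℂ) * (((m : ℝ) : ℂ) * (φ₀ * conj φ₀)) = ((κ * m * ‖φ₀‖ ^ 2 : ℝ) : ℂ) := by rw [hnorm]; push_cast; ring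
  have hB₃ : ((κ : ℝ) : ℂ) * (((m : ℝ) : ℂ) * (c z * φ₀ * conj φ₀)) = conj (((κ : ℝ) : ℂ) * (((m : ℝ) : ℂ) * (φ₀ * conj (c z * φ₀)))) := by
    simp only [map_mul, Complex.conj_conj, Complex.conj_ofReal]; ring
  have hB₄ : ((κ : ℝ) : ℂ) * (((m : ℝ) : ℂ) * (c z * φ₀ * conj (c z * φ₀))) = ((κ * m * ‖c z‖ ^ 2 * ‖φ₀‖ ^ 2 : ℝ) : ℂ) := by
    have h2 : c z * φ₀ * conj (c z * φ₀) = ((‖c z * φ₀‖ ^ 2 : ℝ) : ℂ) := by rw [Complex.mul_conj, Complex.normSq_eq_norm_sq]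
    rw [h2, norm_mul, mul_pow]; push_cast; ring
  have hW : ‖((κ : ℝ) : ℂ) * (((m : ℝ) : ℂ) * (φ₀ * conj (c z * φ₀)))‖ ^ 2 ≤ (κ * m * ‖φ₀‖ ^ 2) * (κ * m * ‖c z‖ ^ 2 * ‖φ₀‖ ^ 2) := by
    rw [norm_mul, norm_mul, norm_mul, Complex.norm_conj, norm_mul, Complex.norm_real, Complex.norm_real, Real.norm_of_nonneg hκ.le, Real.norm_of_nonneg hm.le]
    nlinarith [norm_nonneg φ₀, norm_nonneg (c z), sq_nonneg (κ * m * ‖φ₀‖ * ‖c z‖ * ‖φ₀‖)]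
  have hfour : (((Q z : ℝ)) : ℂ) = ((cμ : ℝ) : ℂ) * (((K : ℝ) : ℂ) *
      ((((T : ℝ) : ℂ) ^ (z + conj z - 2) / (z + conj z - 2)) * (((κ : ℝ) : ℂ) * (((m : ℝ) : ℂ) * (φ₀ * conj φ₀)))
        + (((T : ℝ) : ℂ) ^ (z - conj z) / (z - conj z)) * (((κ : ℝ) : ℂ) * (((m : ℝ) : ℂ) * (φ₀ * conj (c z * φ₀))))
        - (((T : ℝ) : ℂ) ^ (-(z - conj z)) / (z - conj z)) * (((κ : ℝ) : ℂ) * (((m : ℝ) : ℂ) * (c z * φ₀ * conj φ₀)))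
        - (((T : ℝ) : ℂ) ^ (-(z + conj z - 2)) / (z + conj z - 2)) * (((κ : ℝ) : ℂ) * (((m : ℝ) : ℂ) * (c z * φ₀ * conj (c z * φ₀)))))) := hdiag
  exact poleControl_of_fourTerm hcμ hK hT hx hy hQ0 ha hb hW hs₁ hs₂ hB₁ hB₃ hB₄ hfour

end Head

/-! ## §3 The family form on `D₁` -/

section Family

variable (L : Type) [Field L] [NumberField L] [IsCMField L]
variable [MeasurableSpace (quasiSplit (↥(maximalRealSubfield L)) L (IsCMField.complexConj L) 3).Adelic] [BorelSpace (quasiSplit (↥(maximalRealSubfield L)) L (IsCMField.complexConj L) 3).Adelic]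
variable [MeasurableSpace (AdeleRing (𝓞 L) L)ˣ] [BorelSpace (AdeleRing (𝓞 L) L)ˣ]

/-- **[MW] IV.3.12 (a) AT `N = 3` ON `D₁` FROM AN `L²`-HOLOMORPHIC FAMILY ON `D₁`** — the general-box `_on'` edition of ★ `poleControl_continued_cm_three_of_family[_on]`: `D₁ ⊆ D⁺` open preconnected containing
two sub-tube boxes `O₁`, `O₂'`; structural data of ★ (R6k)₃; `φ₀ ≠ 0`; `c̃` holomorphic on `D₁` with (hceq) on the tube; `F : ℂ → L²(X,μ)` holomorphic on `D₁` with `F z = [Λ^T E(φ₀H^z)]` a.e. for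
`z ∈ D₁`, `Re z > 2`.  THEN (a1)∧(a2)∧(a3) at every `z ∈ D₁`. [cite: MoeglinWaldspurger1995, IV.3.12 (a)] [cite: BernsteinLapid2019, §4] [cite: Arthur1980TraceFormulaII, §4] -/
theorem poleControl_continued_cm_three_of_family_on' {D₁ : Set ℂ} (hD₁ : IsOpen D₁) (hD₁c : IsPreconnected D₁) (hD₁sub : D₁ ⊆ {z : ℂ | 1 < z.re ∧ 0 < z.im})
    {O₁ O₂' : Set ℂ} (hO₁ : IsOpen O₁) (hO₁ne : O₁.Nonempty) (hO₁D : O₁ ⊆ D₁) (hO₂' : IsOpen O₂') (hO₂'ne : O₂'.Nonempty) (hO₂'D : O₂' ⊆ D₁)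
    (hsep : ∀ z ∈ O₁, ∀ z' ∈ O₂', 2 < z'.re ∧ z'.re < z.re)
    (μ : Measure (quasiSplit (↥(maximalRealSubfield L)) L (IsCMField.complexConj L) 3).automorphicQuotient) [(quasiSplit (↥(maximalRealSubfield L)) L (IsCMField.complexConj L) 3).IsAutomorphicMeasure μ]
    (νG : Measure (quasiSplit (↥(maximalRealSubfield L)) L (IsCMField.complexConj L) 3).Adelic) [νG.IsHaarMeasure] [νG.IsInvInvariant]
    (μK : Measure ((standardMaximalCompactGL 3 L).comap (adelicVal (↥(maximalRealSubfield L)) L (IsCMField.complexConj L) 3 ((StdForm.antidiagonal 3).over L)) : Subgroup (quasiSplit (↥(maximalRealSubfield L)) L (IsCMField.complexConj L) 3).Adelic))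
    [μK.IsHaarMeasure]
    (νI : Measure (AdeleRing (𝓞 L) L)ˣ) [νI.IsHaarMeasure]
    {𝓕I : Set (AdeleRing (𝓞 L) L)ˣ} (h𝓕I : IsIdeleClassDomain L 𝓕I)
    (ν : Measure ↥(adelicUnipotent (↥(maximalRealSubfield L)) L (IsCMField.complexConj L) 3)) [ν.IsHaarMeasure]
    {𝓕 : Set ↥(adelicUnipotent (↥(maximalRealSubfield L)) L (IsCMField.complexConj L) 3)} (h𝓕N : IsFundamentalDomain ↥(rationalUnipotent (↥(maximalRealSubfield L)) L (IsCMField.complexConj L) 3) 𝓕 ν) (h𝓕1 : ν 𝓕 = 1)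
    (h𝓕c : IsCompact (closure 𝓕))
    {T : ℝ≥0} (hT : 1 ≤ T) {φ₀ : ℂ} (hφ₀ : φ₀ ≠ 0)
    {β : (quasiSplit (↥(maximalRealSubfield L)) L (IsCMField.complexConj L) 3).Adelic → ℝ≥0∞} (hβ : IsCoveringWeight ((arithmeticBorel (↥(maximalRealSubfield L)) L (IsCMField.complexConj L) 3).map (quasiSplit (↥(maximalRealSubfield L)) L (IsCMField.complexConj L) 3).arithmeticSubgroup.subtype) β)
    {c : ℂ → ℂ} (hc : DifferentiableOn ℂ c D₁) (hceq : ∀ z : ℂ, 2 < z.re → c z = (∫ v : ↥(adelicUnipotent (↥(maximalRealSubfield L)) L (IsCMField.complexConj L) 3), (((borelHeight ((quasiSplit (↥(maximalRealSubfield L)) L (IsCMField.complexConj L) 3).toAdelic (weylLongU ((IsCMField.complexConj L : L ≃ₐ[↥(maximalRealSubfield L)] L) : L →+* L) (rfl : (StdForm.antidiagonal 3).over L = (StdForm.antidiagonal 3).over L)) * (v : (quasiSplit (↥(maximalRealSubfield L)) L (IsCMField.complexConj L) 3).Adelic))) : ℝ) : ℂ) ^ z ∂ν))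
    (F : ℂ → Lp ℂ 2 μ) (hFd : DifferentiableOn ℂ F D₁)
    (hFtube : ∀ z ∈ D₁, 2 < z.re → ((F z : Lp ℂ 2 μ) : (quasiSplit (↥(maximalRealSubfield L)) L (IsCMField.complexConj L) 3).automorphicQuotient → ℂ) =ᵐ[μ] (quasiSplit (↥(maximalRealSubfield L)) L (IsCMField.complexConj L) 3).quotFun (truncation ν 𝓕 T (eisensteinSeriesU (flatSectionU (fun _ : (quasiSplit (↥(maximalRealSubfield L)) L (IsCMField.complexConj L) 3).Adelic => φ₀) z))))
    {z : ℂ} (hz : z ∈ D₁) :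
    Real.sqrt ((∫ x in {x : (AdeleRing (𝓞 L) L)ˣ | (IdeleClassGroup.ideleNorm L x : ℝ) ≤ 1} ∩ 𝓕I, (IdeleClassGroup.ideleNorm L x : ℝ) ∂νI) * μK.real Set.univ * ‖c z‖ ^ 2 * ‖φ₀‖ ^ 2) ≤ (z.re - 1) * (T : ℝ) ^ (2 * (z.re - 1)) * Real.sqrt ((∫ x in {x : (AdeleRing (𝓞 L) L)ˣ | (IdeleClassGroup.ideleNorm L x : ℝ) ≤ 1} ∩ 𝓕I, (IdeleClassGroup.ideleNorm L x : ℝ) ∂νI) * μK.real Set.univ * ‖φ₀‖ ^ 2) / |z.im| +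
        Real.sqrt ((z.re - 1) ^ 2 * (T : ℝ) ^ (4 * (z.re - 1)) * ((∫ x in {x : (AdeleRing (𝓞 L) L)ˣ | (IdeleClassGroup.ideleNorm L x : ℝ) ≤ 1} ∩ 𝓕I, (IdeleClassGroup.ideleNorm L x : ℝ) ∂νI) * μK.real Set.univ * ‖φ₀‖ ^ 2) / z.im ^ 2 + ((∫ x in {x : (AdeleRing (𝓞 L) L)ˣ | (IdeleClassGroup.ideleNorm L x : ℝ) ≤ 1} ∩ 𝓕I, (IdeleClassGroup.ideleNorm L x : ℝ) ∂νI) * μK.real Set.univ * ‖φ₀‖ ^ 2) * (T : ℝ) ^ (4 * (z.re - 1))) ∧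
      (∀ {x₁ x₂ η : ℝ}, 0 < x₁ → (z.re - 1) ∈ Set.Icc x₁ x₂ → 0 < η → η ≤ |z.im| →
        (∫ x in {x : (AdeleRing (𝓞 L) L)ˣ | (IdeleClassGroup.ideleNorm L x : ℝ) ≤ 1} ∩ 𝓕I, (IdeleClassGroup.ideleNorm L x : ℝ) ∂νI) * μK.real Set.univ * ‖c z‖ ^ 2 * ‖φ₀‖ ^ 2 ≤ (x₂ * (T : ℝ) ^ (2 * x₂) * Real.sqrt ((∫ x in {x : (AdeleRing (𝓞 L) L)ˣ | (IdeleClassGroup.ideleNorm L x : ℝ) ≤ 1} ∩ 𝓕I, (IdeleClassGroup.ideleNorm L x : ℝ) ∂νI) * μK.real Set.univ * ‖φ₀‖ ^ 2) / η + Real.sqrt (x₂ ^ 2 * (T : ℝ) ^ (4 * x₂) * ((∫ x in {x : (AdeleRing (𝓞 L) L)ˣ | (IdeleClassGroup.ideleNorm L x : ℝ) ≤ 1} ∩ 𝓕I, (IdeleClassGroup.ideleNorm L x : ℝ) ∂νI) * μK.real Set.univ * ‖φ₀‖ ^ 2) / η ^ 2 + ((∫ x in {x : (AdeleRing (𝓞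 L) L)ˣ | (IdeleClassGroup.ideleNorm L x : ℝ) ≤ 1} ∩ 𝓕I, (IdeleClassGroup.ideleNorm L x : ℝ) ∂νI) * μK.real Set.univ * ‖φ₀‖ ^ 2) * (T : ℝ) ^ (4 * x₂))) ^ 2) ∧
      (|z.im| ≤ 1 → (∫ x in {x : (AdeleRing (𝓞 L) L)ˣ | (IdeleClassGroup.ideleNorm L x : ℝ) ≤ 1} ∩ 𝓕I, (IdeleClassGroup.ideleNorm L x : ℝ) ∂νI) * μK.real Set.univ * ‖c z‖ ^ 2 * ‖φ₀‖ ^ 2 ≤ ((z.re - 1) * (T : ℝ) ^ (2 * (z.re - 1)) * Real.sqrt ((∫ x in {x : (AdeleRing (𝓞 L) L)ˣ | (IdeleClassGroup.ideleNorm L x : ℝ) ≤ 1} ∩ 𝓕I, (IdeleClassGroup.ideleNorm L x : ℝ) ∂νI) * μK.real Set.univ * ‖φ₀‖ ^ 2) +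
        Real.sqrt ((z.re - 1) ^ 2 * (T : ℝ) ^ (4 * (z.re - 1)) * ((∫ x in {x : (AdeleRing (𝓞 L) L)ˣ | (IdeleClassGroup.ideleNorm L x : ℝ) ≤ 1} ∩ 𝓕I, (IdeleClassGroup.ideleNorm L x : ℝ) ∂νI) * μK.real Set.univ * ‖φ₀‖ ^ 2) + ((∫ x in {x : (AdeleRing (𝓞 L) L)ˣ | (IdeleClassGroup.ideleNorm L x : ℝ) ≤ 1} ∩ 𝓕I, (IdeleClassGroup.ideleNorm L x : ℝ) ∂νI) * μK.real Set.univ * ‖φ₀‖ ^ 2) * (T : ℝ) ^ (4 * (z.re - 1)))) ^ 2 / z.im ^ 2)  := by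
  obtain ⟨hΦ₁, hΦ₂, hQ⟩ := pairing_of_differentiableOn hD₁ hFd
  have hraw : ∀ z ∈ D₁, ∀ z' ∈ D₁, 2 < z.re → 2 < z'.re →
      ⟪F z', F z⟫_ℂ = ∫ x, (quasiSplit (↥(maximalRealSubfield L)) L (IsCMField.complexConj L) 3).quotFun (truncation ν 𝓕 T (eisensteinSeriesU (flatSectionU (fun _ : (quasiSplit (↥(maximalRealSubfield L)) L (IsCMField.complexConj L) 3).Adelic => φ₀) z))) x * conj ((quasiSplit (↥(maximalRealSubfield L)) L (IsCMField.complexConj L) 3).quotFun (truncation ν 𝓕 T (eisensteinSeriesU (flatSectionU (fun _ : (quasiSplit (↥(maximalRealSubfield L)) L (IsCMField.complexConj L) 3).Adelic => φ₀) z'))) x) ∂μ := by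
    intro z hz z' hz' hz1 hz'1
    rw [MeasureTheory.L2.inner_def]
    refine integral_congr_ae ?_
    filter_upwards [hFtube z hz hz1, hFtube z' hz' hz'1] with x hx hx'
    rw [hx, hx', RCLike.inner_apply, mul_comm]
  obtain ⟨cμ, K, hcμ, hK, h4⟩ := exists_fourTerm_tube_cm_three L μ νG μK νI h𝓕I ν h𝓕N h𝓕1 h𝓕c T hT φ₀ hβ c hceq
  have hκr : 0 < (∫ x in {x : (AdeleRing (𝓞 L) L)ˣ | (IdeleClassGroup.ideleNorm L x : ℝ) ≤ 1} ∩ 𝓕I, (IdeleClassGroup.ideleNorm L x : ℝ) ∂νI) := idelicBracket_pos νI h𝓕I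
  have hmK : 0 < μK.real Set.univ := measureReal_maximalCompact_pos μK
  have hrel : ∀ z ∈ D₁, ∀ z' ∈ D₁, 2 < z'.re → z'.re < z.re →
      ⟪F z', F z⟫_ℂ = ((cμ : ℝ) : ℂ) * (((K : ℝ) : ℂ) *
        ((((T : ℝ) : ℂ) ^ (z + conj z' - 2) / (z + conj z' - 2)) * ((((∫ x in {x : (AdeleRing (𝓞 L) L)ˣ | (IdeleClassGroup.ideleNorm L x : ℝ) ≤ 1} ∩ 𝓕I, (IdeleClassGroup.ideleNorm L x : ℝ) ∂νI) : ℝ) : ℂ) * (((μK.real Set.univ : ℝ) : ℂ) * (φ₀ * conj φ₀)))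
          + (((T : ℝ) : ℂ) ^ (z - conj z') / (z - conj z')) * ((((∫ x in {x : (AdeleRing (𝓞 L) L)ˣ | (IdeleClassGroup.ideleNorm L x : ℝ) ≤ 1} ∩ 𝓕I, (IdeleClassGroup.ideleNorm L x : ℝ) ∂νI) : ℝ) : ℂ) * (((μK.real Set.univ : ℝ) : ℂ) * (φ₀ * conj (c z' * φ₀))))
          - (((T : ℝ) : ℂ) ^ (-(z - conj z')) / (z - conj z')) * ((((∫ x in {x : (AdeleRing (𝓞 L) L)ˣ | (IdeleClassGroup.ideleNorm L x : ℝ) ≤ 1} ∩ 𝓕I, (IdeleClassGroup.ideleNorm L x : ℝ) ∂νI) : ℝ) : ℂ) * (((μK.real Set.univ : ℝ) : ℂ) * (c z * φ₀ * conj φ₀)))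
          - (((T : ℝ) : ℂ) ^ (-(z + conj z' - 2)) / (z + conj z' - 2)) * ((((∫ x in {x : (AdeleRing (𝓞 L) L)ˣ | (IdeleClassGroup.ideleNorm L x : ℝ) ≤ 1} ∩ 𝓕I, (IdeleClassGroup.ideleNorm L x : ℝ) ∂νI) : ℝ) : ℂ) * (((μK.real Set.univ : ℝ) : ℂ) * (c z * φ₀ * conj (c z' * φ₀)))))) := by
    intro z hz z' hz' h1 h2
    rw [hraw z hz z' hz' (h1.trans h2) h1]
    exact h4 z z' h1 h2
  exact poleControl_continued_cm_three_of_pairing_on' hD₁ hD₁c hD₁sub hO₁ hO₁ne hO₁D hO₂' hO₂'ne hO₂'D hsep (T := (T : ℝ)) (by exact_mod_cast hT) hcμ hK hκr hmK hφ₀ hc (Φ := fun z z' => ⟪F z', F z⟫_ℂ) hΦ₁ hΦ₂ hrel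
    (Q := fun z => ‖F z‖ ^ 2) hQ hz

end Family

end Summit.HodgeConjecture.HodgeConjecture.Cruxes.H413.K2E1MaassSelbergContinuedOnBoxesCMThree

end
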